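import Summits.CriticalPhenomena.PercolationContinuityZ3.Theorems.PercNearOneGluingNoHeavyQuantGatedSliceWindow
import Summits.CriticalPhenomena.PercolationContinuityZ3.Theorems.PercNearOneGluingNoHeavyQuantGateMoveBlobCells
import Summits.CriticalPhenomena.PercolationContinuityZ3.Theorems.PercNearOneGluingNoHeavyQuantSliceHeavy
import HarnessLib

/-!
# QUANT lane R8, T-DEC, leg (III), blob case — the law-level target `GatedSliceMixLaw`, FIRST PROVED CELL: the two-point laws through the zero
# (`k₁ = 0`) with `k₂ ≥ a` — there `θ = 0` works (the moved law of the gated two-point law is DEC), by typer g27's one-layer move under its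
# (here vacuous) support hypothesis on top of the slice theorem

builds on p205010 (kernel theorem, internal audit signed; external expert review pending)

Support file (`--supports stmt-CriticalPhenomena-4575`), QUANT lane typer seat prim-quant-stmt (gen 29), rung R8 of
`run/shared/lean/prim/quant/LADDER.md`.  Theorems only, standard axioms, no sorries, no definitions.  Statements: `…QuantGatedSliceWindow`
(`GatedSliceMixLaw`, reduction `GatedSliceMixLaw → GatedSliceWindowDEC` in `…QuantGatedSliceWindowReduction`).

THE CELL (memo GATED-SLICE-DUAL-G29 §4(a)).  For `μ₂ = {0, k₂; λ}` of mean `T = S/(1−z)` the gated law `ν₂ := zδ₀ + (1−z)μ₂ = {0, k₂; S/k₂}` satisfies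
EVERY hypothesis of the window form: probability law on `{0..M}`, mean `S`, zero mass `1 − S/k₂ ≥ z` (`k₂ ≥ T`), top-affordable, and DEC at EVERY layer
(the single component `{0, k₂; S/k₂}` is a giant pair of gate `S/k₂ ≥ y` below `k₂` and a credit pair of credit exactly `S` from `k₂` on).  When moreover
`k₂ ≥ a` no atom of `ν₂` lies strictly between `0` and `a`, so typer g27's `decAtT_gateMoveBlob` (its `hsupp` vacuous) on top of `sliceClosedWindowT_holds`
gives DEC of the moved law `slice ν₂ a g + gz(δ₀ − δ_a) = zδ₀ + (1−z)·slice μ₂ a g` (`gateMove_eq_gate_slice`) at `(y, S + ag(1−z), j)`: the conclusion of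
`GatedSliceMixLaw` with `θ = 0`, for every `h`.  REMAINING cells of `GatedSliceMixLaw`: `k₁ = 0, k₂ < a` (then `a` is not a `t`-low; small explicit flow) and
`k₁ ≥ 1` (the genuine mixtures, memo §6).

* `LawDec.decAtT_zeroPair_allLayers` — `{0, k₂; S/k₂}` is DEC at `(y, S, i)` on `{0..M}` for every layer `i` (`y·M ≤ S`, `k₂ ≤ M`, `0 < S ≤ k₂`).
* **`LawDec.gatedSliceMixLaw_zero_ge`** — `GatedSliceMixLaw`'s conclusion for `k₁ = 0`, `a ≤ k₂`, with `θ = 0`.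

[this work]; one-layer move under `hsupp`: typer g27; slice theorem: typer g24 / census-2 g54–g55 (this lane).  The gluing rows served
[cite: KozmaNitzan2024, Conjecture 3 (p. 15)]; product measure [cite: Grimmett1999, §1.3 p. 10].
-/

noncomputable section

namespace Summit.CriticalPhenomena.PercolationContinuityZ3.Theorems

namespace Quant

open Finset

/-- the two-point law `{lo, hi; g}` (as in `…QuantLawDEC`) -/
local notation3 "TP[" lo ", " hi ", " g ", " h "]" =>
  (g : ℝ) * (if (h : ℕ) = (hi : ℕ) then (1 : ℝ) else 0) + (1 - (g : ℝ)) * (if (h : ℕ) = (lo : ℕ) then (1 : ℝ) else 0)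

namespace LawDec

/-- **the zero pair `{0, k; S/k}` is DEC at `(y, S, i)` for EVERY layer `i`** (`0 < y`, `0 < S`, `S ≤ k ≤ M`, `y·M ≤ S`): below `k` it is a giant pair
of gate `S/k ≥ y`, from `k` on a credit pair of credit exactly `S`. [this work] -/
theorem decAtT_zeroPair_allLayers (y S : ℝ) (M k i : ℕ) (hy0 : 0 < y) (hS0 : 0 < S) (hSk : S ≤ (k : ℝ)) (hkM : k ≤ M)
    (hta : y * (M : ℝ) ≤ S) :
    DECAtT y S i M (fun q => TP[0, k, S / k, q]) := by
  have hk0 : (0 : ℝ) < k := lt_of_lt_of_le hS0 hSk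
  have hkpos : 0 < k := by exact_mod_cast hk0
  have hγ0 : 0 ≤ S / (k : ℝ) := div_nonneg hS0.le hk0.le
  have hγ1 : S / (k : ℝ) ≤ 1 := by rw [div_le_one hk0]; exact hSk
  have hyγ : y ≤ S / (k : ℝ) := by
    rw [le_div_iff₀ hk0]
    have : y * (k : ℝ) ≤ y * M := mul_le_mul_of_nonneg_left (by exact_mod_cast hkM) hy0.le
    linarith
  refine decAtT_single y S i M 0 k (S / k) ⟨hγ0, hγ1⟩ (Nat.zero_le k) hkM ?_
  by_cases hik : i + 1 ≤ k
  · exact Or.inr (Or.inl ⟨hkpos, hik, hyγ⟩)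
  · refine Or.inr (Or.inr ⟨hkpos, by omega, ?_⟩)
    rw [if_pos hyγ]
    simp only [Nat.cast_zero, mul_zero, sub_zero, zero_add]
    rw [mul_div_cancel₀ _ (ne_of_gt hk0)]

/-- **`GatedSliceMixLaw`, CELL `k₁ = 0`, `k₂ ≥ a` (θ = 0).**  Frame of `GatedSliceMixLaw`; `μ₂ = {0, k₂; λ}` with `(1−z)·k₂·λ = S` and `a ≤ k₂ ≤ M`.
Then the moved law `zδ₀ + (1−z)·slice μ₂ a g` is DEC at `(y, S + ag(1−z), j)` on `{0..M+a}`, so `θ = 0` witnesses the conjecture's conclusion (the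
weak-mid law is not needed).  Proof: `ν₂ = {0, k₂; (1−z)λ}` is DEC at every layer (`decAtT_zeroPair_allLayers`), its slice is DEC at `S + ag` by
`sliceClosedWindowT_holds`, and `decAtT_gateMoveBlob` moves the gate-zero (`hsupp` vacuous since `a ≤ k₂`); `gateMove_eq_gate_slice` identifies the law. [this work] -/
theorem gatedSliceMixLaw_zero_ge (y z g S lam : ℝ) (a j M h k₂ : ℕ)
    (hy0 : 0 < y) (hy1 : y < 1) (hz0 : 0 ≤ z) (hz1 : z < 1) (hg1 : g ≤ 1) (hyg : y ≤ (1 - z) * g) (ha : 1 ≤ a)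
    (hjM : j < M + a) (hS0 : 0 < S) (hta : y * (M : ℝ) ≤ S)
    (hk₂M : k₂ ≤ M) (hlam0 : 0 ≤ lam) (hlam1 : lam ≤ 1) (hmean : (1 - z) * (((0 : ℕ) : ℝ) + ((k₂ : ℝ) - (0 : ℕ)) * lam) = S)
    (hak : a ≤ k₂) :
    ∃ θ : ℝ, 0 ≤ θ ∧ θ < 1 ∧
      DECAtT y (S + (a : ℝ) * g * (1 - z)) j (M + a)
        (fun p => θ * weakMidLaw S g h a p
          + (1 - θ) * (z * (if p = 0 then (1 : ℝ) else 0) + (1 - z) * slice (fun q => TP[0, k₂, lam, q]) a g p)) := by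
  refine ⟨0, le_rfl, zero_lt_one, ?_⟩
  have h1z : 0 < 1 - z := by linarith
  have hmean' : (1 - z) * lam * (k₂ : ℝ) = S := by
    rw [← hmean]; simp only [Nat.cast_zero, zero_add, sub_zero]; ring
  have hk0 : (0 : ℝ) < k₂ := by
    rcases (Nat.cast_nonneg k₂ : (0 : ℝ) ≤ k₂).eq_or_lt with h0 | h0
    · exfalso; rw [← h0, mul_zero] at hmean'; linarith
    · exact h0
  -- the gated two-point law ν₂ = {0, k₂; (1−z)λ} = {0, k₂; S/k₂}
  set γ : ℝ := (1 - z) * lam with hγ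
  have hγeq : γ = S / (k₂ : ℝ) := by rw [hγ, eq_div_iff (ne_of_gt hk0)]; exact hmean'
  have hSk : S ≤ (k₂ : ℝ) := by
    rw [← hmean']
    have : (1 - z) * lam ≤ 1 := by nlinarith
    nlinarith
  set ν₂ : ℕ → ℝ := fun q => TP[0, k₂, γ, q] with hν₂
  have hγ0 : 0 ≤ γ := mul_nonneg h1z.le hlam0
  have hγ1 : γ ≤ 1 := by rw [hγ]; nlinarith
  have hk₂0 : k₂ ≠ 0 := by
    intro h0; rw [h0, Nat.cast_zero] at hk0; exact lt_irrefl _ hk0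
  have hν₂0 : ∀ q, 0 ≤ ν₂ q := by
    intro q; simp only [hν₂]
    refine add_nonneg (mul_nonneg hγ0 ?_) (mul_nonneg (by linarith) ?_) <;> split_ifs <;> norm_num
  have hν₂M : ∀ q, M < q → ν₂ q = 0 := by
    intro q hq; simp only [hν₂]
    rw [if_neg (by omega), if_neg (by omega)]; ring
  have hν₂1 : ∑ q ∈ Finset.range (M + 1), ν₂ q = 1 := by
    simp only [hν₂]
    rw [Finset.sum_add_distrib, ← Finset.mul_sum, ← Finset.mul_sum, Finset.sum_ite_eq' (Finset.range (M + 1)) k₂,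
      Finset.sum_ite_eq' (Finset.range (M + 1)) 0, if_pos (Finset.mem_range.2 (by omega)), if_pos (Finset.mem_range.2 (by omega))]
    ring
  have hν₂mean : S = ∑ q ∈ Finset.range (M + 1), (q : ℝ) * ν₂ q := by
    simp only [hν₂]
    have e : ∀ q ∈ Finset.range (M + 1), (q : ℝ) * (γ * (if q = k₂ then (1 : ℝ) else 0) + (1 - γ) * (if q = 0 then (1 : ℝ) else 0))
        = γ * (if q = k₂ then (k₂ : ℝ) else 0) := by
      intro q _
      by_cases hq : q = k₂
      · subst hq; rw [if_pos rfl, if_pos rfl, if_neg hk₂0]; ring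
      · rw [if_neg hq, if_neg hq]
        by_cases hq0 : q = 0
        · subst hq0; simp
        · rw [if_neg hq0]; ring
    rw [Finset.sum_congr rfl e, ← Finset.mul_sum, Finset.sum_ite_eq' (Finset.range (M + 1)) k₂, if_pos (Finset.mem_range.2 (by omega)),
      hγ, ← hmean']
  have hν₂zero : ν₂ 0 = 1 - γ := by
    simp only [hν₂]
    split_ifs <;> (first | (exfalso; omega) | ring)
  have hzν : z ≤ ν₂ 0 := by
    rw [hν₂zero, hγ]
    nlinarith [mul_le_mul_of_nonneg_left hlam1 h1z.le]
  -- ν₂ is DEC at every layer; the slice theorem; the one-layer move (no atom strictly between 0 and a)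
  have hwin : ∀ i, i ≤ j → j ≤ i + a → DECAtT y S i M ν₂ := by
    intro i _ _
    have := decAtT_zeroPair_allLayers y S M k₂ i hy0 hS0 hSk hk₂M hta
    rwa [← hγeq] at this
  have hyg' : y ≤ g := hyg.trans (by nlinarith [le_of_lt (lt_of_lt_of_le hy0 hyg)])
  have hΛ : DECAtT y (S + (a : ℝ) * g) j (M + a) (slice ν₂ a g) :=
    sliceClosedWindowT_holds y g S M a j ν₂ hy0 hy1 hyg' hg1 ha hν₂0 hν₂M hν₂1 hjM hwin
  have hmove := decAtT_gateMoveBlob y z g S a j M ν₂ hy0 hy1 hz0 hg1 hyg ha hν₂0 hν₂M hν₂1 hν₂mean hta hzν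
    (fun k hk hka => by
      simp only [hν₂]
      rw [if_neg (by omega), if_neg (by omega)]; ring) hΛ
  -- identify the laws and the targets
  have ht : S + (a : ℝ) * g * (1 - z) = S + (a : ℝ) * g - z * (a : ℝ) * g := by ring
  rw [ht]
  have hlaw : (fun p => (0 : ℝ) * weakMidLaw S g h a p
      + (1 - 0) * (z * (if p = 0 then (1 : ℝ) else 0) + (1 - z) * slice (fun q => TP[0, k₂, lam, q]) a g p))
      = fun p => slice ν₂ a g p + g * z * ((if p = 0 then (1 : ℝ) else 0) - (if p = a then (1 : ℝ) else 0)) := by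
    funext p
    rw [gateMove_eq_gate_slice ν₂ a g z ha hz1 p]
    have hμ : (fun k => (ν₂ k - z * (if k = 0 then (1 : ℝ) else 0)) / (1 - z)) = fun q => TP[0, k₂, lam, q] := by
      funext q
      simp only [hν₂, hγ]
      rw [div_eq_iff (ne_of_gt h1z)]
      by_cases hq : q = k₂
      · subst hq; rw [if_pos rfl, if_neg hk₂0]; ring
      · rw [if_neg hq]
        by_cases hq0 : q = 0
        · subst hq0; rw [if_pos rfl]; ring
        · rw [if_neg hq0]; ring
    rw [hμ]; ring
  rw [hlaw]
  exact hmove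

end LawDec

end Quant

end Summit.CriticalPhenomena.PercolationContinuityZ3.Theorems
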